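import Summits.KontsevichZagierPeriods.KontsevichZagierPeriods.Theorems.SymplecticScissorsRealOnePeriodRelationsStubCellsAux

/-!
# `RealOnePeriodRelations` (stmt-KontsevichZagierPeriods-10042), line `nash-retraction-thin-strip`,
# reshape 4 (the unconditional elliptic layer): stub `stub_ellRealise`

RULE 2 ALONG THE CUBIC REPARAMETRISATION.  In the elliptic layer a representation `r` on a bounded cell
`{z | z 0 ∈ (a, b)}` with algebraic end points is realised on the unit interval by the representation
`R` with integrand `r(x(t)) · x′(t)`, where `x(t) = a + (b − a)(3t² − 2t³)` (so that the lifted path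
`(x(t), √f(x(t)))` is `C¹` up to the end points).  This file proves `[r] − [R] ∈ M₁`: the chart `x(·)`
is `ℚ`-semialgebraic (a polynomial with the algebraic coefficients `a`, `b − a`), has the positive
`ℚ`-semialgebraic derivative `x′(t) = (b − a)(6t − 6t²)` on `(0,1)`, is injective there (strictly
increasing) and maps `(0,1)` onto `(a,b)` (intermediate value theorem); Kontsevich–Zagier's rule (2)
in dimension one (`helper_cells_1`, applied to `R`) produces the push-forward `s` of `R` along `x(·)`,
whose domain is `{z | z 0 ∈ (a,b)}` and whose integrand agrees with that of `r` there, so that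
`[R] − [s] ∈ M₁` (rule 2) and `[r] − [s] ∈ M₁` (rule 1b).

References: M. Kontsevich, D. Zagier, *Periods* (2001), §1.2; J. Bochnak, M. Coste, M.-F. Roy, *Real
Algebraic Geometry* (1998), §2.2.
-/

noncomputable section
open Set MeasureTheory Filter Topology
open Literature.NumberTheory.Transcendental Literature.ModelTheory.ExponentialFields
open Summit.KontsevichZagierPeriods.SymplecticScissors.RealOnePeriodRelationsNegative (M₁ H₁)

namespace Summit.KontsevichZagierPeriods.SymplecticScissors.RealOnePeriodRelations.EllipticLayer

/-- The cubic chart `x(t) = a + (b − a)(3t² − 2t³)` has derivative `(b − a)(6t − 6t²)`. [folklore] -/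
theorem hasDerivAt_cubicChart (a b t : ℝ) :
    HasDerivAt (fun t : ℝ => a + (b - a) * (3 * t ^ 2 - 2 * t ^ 3)) ((b - a) * (6 * t - 6 * t ^ 2)) t := by
  have h2 : HasDerivAt (fun x : ℝ => x ^ 2) (2 * t) t := by simpa using hasDerivAt_pow 2 t
  have h3 : HasDerivAt (fun x : ℝ => x ^ 3) (3 * t ^ 2) t := by simpa using hasDerivAt_pow 3 t
  have h := (((h2.const_mul 3).fun_sub (h3.const_mul 2)).const_mul (b - a)).const_add a
  exact h.congr_deriv (by ring)

/-- The derivative `(b − a)(6t − 6t²)` of the cubic chart is positive on `(0,1)` when `a < b`. [folklore] -/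
theorem cubicChart_deriv_pos {a b : ℝ} (hab : a < b) {t : ℝ} (ht : t ∈ Ioo (0 : ℝ) 1) :
    0 < (b - a) * (6 * t - 6 * t ^ 2) :=
  mul_pos (sub_pos.mpr hab) (by nlinarith [ht.1, ht.2])

/-- The cubic chart is strictly increasing on `[0,1]` when `a < b`. [folklore] -/
theorem strictMonoOn_cubicChart {a b : ℝ} (hab : a < b) :
    StrictMonoOn (fun t : ℝ => a + (b - a) * (3 * t ^ 2 - 2 * t ^ 3)) (Icc 0 1) := by
  refine strictMonoOn_of_deriv_pos (convex_Icc 0 1) (by fun_prop) fun x hx => ?_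
  rw [interior_Icc] at hx
  rw [(hasDerivAt_cubicChart a b x).deriv]
  exact cubicChart_deriv_pos hab hx

/-- The cubic chart maps `(0,1)` into `(a,b)`. [folklore] -/
theorem cubicChart_mem_Ioo {a b : ℝ} (hab : a < b) {t : ℝ} (ht : t ∈ Ioo (0 : ℝ) 1) :
    a + (b - a) * (3 * t ^ 2 - 2 * t ^ 3) ∈ Ioo a b := by
  have hmono := strictMonoOn_cubicChart hab
  have h0 := hmono (left_mem_Icc.2 zero_le_one) (Ioo_subset_Icc_self ht) ht.1
  have h1 := hmono (Ioo_subset_Icc_self ht) (right_mem_Icc.2 zero_le_one) ht.2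
  norm_num at h0 h1
  exact ⟨by linarith, by linarith⟩

/-- The cubic chart maps `(0,1)` onto `(a,b)` (intermediate value theorem). [folklore] -/
theorem exists_cubicChart_eq {a b x : ℝ} (hx : x ∈ Ioo a b) :
    ∃ t ∈ Ioo (0 : ℝ) 1, a + (b - a) * (3 * t ^ 2 - 2 * t ^ 3) = x := by
  have hcont : Continuous (fun t : ℝ => a + (b - a) * (3 * t ^ 2 - 2 * t ^ 3)) := by fun_prop
  have h := intermediate_value_Ioo zero_le_one hcont.continuousOn
    (f := fun t : ℝ => a + (b - a) * (3 * t ^ 2 - 2 * t ^ 3))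
  have h0 : a + (b - a) * (3 * (0 : ℝ) ^ 2 - 2 * (0 : ℝ) ^ 3) = a := by ring
  have h1 : a + (b - a) * (3 * (1 : ℝ) ^ 2 - 2 * (1 : ℝ) ^ 3) = b := by ring
  rw [h0, h1] at h
  exact h hx

/-- **Stub `stub_ellRealise`** — RULE 2 ALONG THE CUBIC REPARAMETRISATION: a representation `r` on
`{z | z 0 ∈ (a,b)}` (`a < b` algebraic) and the representation `R` on `{z | z 0 ∈ (0,1)}` with integrand
`r(x(t)) · x′(t)`, `x(t) = a + (b − a)(3t² − 2t³)`, differ by an element of `M₁`: push `R` forward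
along the `ℚ`-semialgebraic injective chart `x(·)` (rule 2, `helper_cells_1`); the push-forward has the
domain and, on it, the integrand of `r` (rule 1b). [cite: KontsevichZagier2001, §1.2 rule (2)] -/
theorem stub_ellRealise : ∀ (a b : ℝ), IsAlgebraic ℚ a → IsAlgebraic ℚ b → a < b →
    ∀ (r R : KZ.IntegralRep 1), r.domain = {z | z 0 ∈ Set.Ioo a b} → R.domain = {z | z 0 ∈ Set.Ioo (0 : ℝ) 1} →
    (∀ t ∈ Set.Ioo (0 : ℝ) 1, R.integrand (fun _ => t) =
        r.integrand (fun _ => (a + (b - a) * (3 * t ^ 2 - 2 * t ^ 3))) * ((b - a) * (6 * t - 6 * t ^ 2))) →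
    KZ.of r - KZ.of R ∈ M₁ := by
  intro a b ha hb hab r R hr hR hRi
  -- the chart and its derivative, as opaque functions with their defining equations
  obtain ⟨φ, hφ⟩ : ∃ φ : ℝ → ℝ, ∀ t, φ t = a + (b - a) * (3 * t ^ 2 - 2 * t ^ 3) := ⟨_, fun _ => rfl⟩
  obtain ⟨φ', hφ'⟩ : ∃ φ' : ℝ → ℝ, ∀ t, φ' t = (b - a) * (6 * t - 6 * t ^ 2) := ⟨_, fun _ => rfl⟩
  have hφfun : φ = fun t => a + (b - a) * (3 * t ^ 2 - 2 * t ^ 3) := funext hφ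
  have hmemR : ∀ p : Fin 1 → ℝ, p ∈ R.domain ↔ p 0 ∈ Ioo (0 : ℝ) 1 := fun p => by rw [hR]; rfl
  have hmemr : ∀ p : Fin 1 → ℝ, p ∈ r.domain ↔ p 0 ∈ Ioo a b := fun p => by rw [hr]; rfl
  -- semialgebraicity of the chart and of its derivative (polynomials with algebraic coefficients)
  have hσ := R.isSemialgebraic_domain
  have h0 : IsSemialgebraicFunOn ℚ R.domain (fun p : Fin 1 → ℝ => p 0) := isSemialgebraicFunOn_apply hσ 0
  have hca : IsSemialgebraicFunOn ℚ R.domain (fun _ => a) := isSemialgebraicFunOn_const_of_isAlgebraic hσ ha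
  have hcba : IsSemialgebraicFunOn ℚ R.domain (fun _ => b - a) :=
    isSemialgebraicFunOn_const_of_isAlgebraic hσ (hb.sub ha)
  have hc2 : IsSemialgebraicFunOn ℚ R.domain (fun _ => (2 : ℝ)) := isSemialgebraicFunOn_const_ofNat hσ 2
  have hc3 : IsSemialgebraicFunOn ℚ R.domain (fun _ => (3 : ℝ)) := isSemialgebraicFunOn_const_ofNat hσ 3
  have hc6 : IsSemialgebraicFunOn ℚ R.domain (fun _ => (6 : ℝ)) := isSemialgebraicFunOn_const_ofNat hσ 6
  have hφs : IsSemialgebraicFunOn ℚ R.domain (fun p => φ (p 0)) :=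
    (hca.fun_add (hcba.fun_mul ((hc3.fun_mul (h0.fun_pow 2)).fun_sub (hc2.fun_mul (h0.fun_pow 3))))).congr
      fun p _ => (hφ (p 0)).symm
  have hφ's : IsSemialgebraicFunOn ℚ R.domain (fun p => φ' (p 0)) :=
    (hcba.fun_mul ((hc6.fun_mul h0).fun_sub (hc6.fun_mul (h0.fun_pow 2)))).congr
      fun p _ => (hφ' (p 0)).symm
  -- calculus of the chart
  have hder : ∀ t : ℝ, HasDerivAt φ (φ' t) t := fun t => by
    rw [hφfun, hφ']
    exact hasDerivAt_cubicChart a b t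
  have hpos : ∀ t ∈ Ioo (0 : ℝ) 1, 0 < φ' t := fun t ht => by
    rw [hφ']
    exact cubicChart_deriv_pos hab ht
  have hmono : StrictMonoOn φ (Icc 0 1) := by
    rw [hφfun]
    exact strictMonoOn_cubicChart hab
  have hmaps : ∀ t ∈ Ioo (0 : ℝ) 1, φ t ∈ Ioo a b := fun t ht => by
    rw [hφ]
    exact cubicChart_mem_Ioo hab ht
  have hsurj : ∀ x ∈ Ioo a b, ∃ t ∈ Ioo (0 : ℝ) 1, φ t = x := fun x hx => by
    simp only [hφ]
    exact exists_cubicChart_eq hx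
  have hinj : InjOn (fun p : Fin 1 → ℝ => fun _ : Fin 1 => φ (p 0)) R.domain := by
    intro p hp p' hp' h
    have h0 : φ (p 0) = φ (p' 0) := congrFun h 0
    have : p 0 = p' 0 :=
      hmono.injOn (Ioo_subset_Icc_self ((hmemR p).1 hp)) (Ioo_subset_Icc_self ((hmemR p').1 hp')) h0
    rw [KZ.eq_const_apply_zero p, KZ.eq_const_apply_zero p', this]
  -- rule 2: push `R` forward along the chart
  obtain ⟨s, hsdom, hsi, hrel⟩ := helper_cells_1 R φ φ' hφs hφ's (fun p _ => hder (p 0))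
    (fun p hp => (hpos _ ((hmemR p).1 hp)).ne') hinj
  -- the push-forward has the domain of `r` …
  have hsr : s.domain = r.domain := by
    rw [hsdom, hr]
    ext z
    constructor
    · rintro ⟨p, hp, rfl⟩
      exact hmaps _ ((hmemR p).1 hp)
    · intro hz
      obtain ⟨t, ht, htz⟩ := hsurj _ hz
      refine ⟨fun _ => t, (hmemR _).2 ht, ?_⟩
      rw [KZ.eq_const_apply_zero z]
      funext
      exact htz
  -- … and, on it, the integrand of `r`
  have heq : EqOn r.integrand s.integrand r.domain := by
    intro p hp
    obtain ⟨t, ht, htp⟩ := hsurj _ ((hmemr p).1 hp)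
    have h := hsi (fun _ => t) ((hmemR _).2 ht)
    rw [hRi t ht, ← hφ t, hφ' t, abs_of_pos (cubicChart_deriv_pos hab ht),
      mul_div_cancel_right₀ _ (cubicChart_deriv_pos hab ht).ne'] at h
    rw [KZ.eq_const_apply_zero p, ← htp]
    exact h.symm
  have h2 : KZ.of r - KZ.of s ∈ M₁ := HomotopyInvariance.of_sub_of_mem_of_eqOn r s hsr heq
  have e : KZ.of r - KZ.of R = (KZ.of r - KZ.of s) - (KZ.of R - KZ.of s) := by abel
  rw [e]
  exact M₁.sub_mem h2 hrel

end Summit.KontsevichZagierPeriods.SymplecticScissors.RealOnePeriodRelations.EllipticLayer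

end
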